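import Mathlib

/-!
# Iterating a single-coordinate integral bound over a finite product measure

Abstract link-by-link induction used in the integrability half of the a-priori bound on
phase-quenched moments (line `crossing-split-integrability`): if integrating out any single
coordinate `e` of a nonnegative measurable function `f` on a finite product `E → X` of
identical probability spaces costs at most a factor `C`, i.e.
`∫⁻ g, f (update x e g) ∂μ ≤ C * f x` for every `e` and every configuration `x`, then the
full product integral satisfies `∫⁻ x, f x ∂(Measure.pi fun _ => μ) ≤ C ^ card E * f x₀`
for every reference configuration `x₀`.

The proof is a `Finset` induction on the set of integrated coordinates, phrased with
Mathlib's marginal integrals `MeasureTheory.lmarginal` (`∫⋯∫⁻_s, f ∂μ`).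
-/

noncomputable section

open MeasureTheory

namespace Summit.QuantumFields.QCD.Cruxes.PhaseQuenchedFlavourDecay.CrossingSplitIntegrability

/-- Marginal version of the iteration: integrating out the coordinates of a finset `t`
costs at most a factor `C ^ t.card`, pointwise in the remaining configuration. -/
theorem lmarginal_le_pow_card_mul {E X : Type} [DecidableEq E] [MeasurableSpace X]
    (μ : Measure X) [IsProbabilityMeasure μ] {f : (E → X) → ENNReal} (hf : Measurable f)
    {C : ENNReal}
    (hC : ∀ (e : E) (x : E → X), ∫⁻ g, f (Function.update x e g) ∂μ ≤ C * f x)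
    (t : Finset E) (x : E → X) :
    (∫⋯∫⁻_t, f ∂(fun _ : E => μ)) x ≤ C ^ t.card * f x := by
  induction t using Finset.induction_on generalizing x with
  | empty => simp [lmarginal_empty]
  | insert e t he ih =>
    rw [lmarginal_insert _ hf he, Finset.card_insert_of_notMem he, pow_succ, mul_assoc]
    calc ∫⁻ g, (∫⋯∫⁻_t, f ∂fun _ : E => μ) (Function.update x e g) ∂μ
        ≤ ∫⁻ g, C ^ t.card * f (Function.update x e g) ∂μ :=
          lintegral_mono fun g => ih _
      _ = C ^ t.card * ∫⁻ g, f (Function.update x e g) ∂μ :=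
          lintegral_const_mul _ (hf.comp (measurable_update x))
      _ ≤ C ^ t.card * (C * f x) := mul_le_mul_right (hC e x) _

/-- **Link-by-link iteration of a single-coordinate bound.** On a finite product of
identical probability spaces, if integrating out any one coordinate of the measurable
function `f` costs at most a factor `C` (uniformly in the coordinate and the configuration),
then the full product integral of `f` is bounded by `C ^ Fintype.card E * f x₀` for every
reference configuration `x₀`. -/
theorem stub_piMarginalInduction :
    ∀ (E X : Type) [Fintype E] [DecidableEq E] [MeasurableSpace X] (μ : MeasureTheory.Measure X)
      [MeasureTheory.IsProbabilityMeasure μ] (f : (E → X) → ENNReal), Measurable f → ∀ C : ENNReal,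
      (∀ (e : E) (x : E → X), ∫⁻ g, f (Function.update x e g) ∂μ ≤ C * f x) →
        ∀ x₀ : E → X, ∫⁻ x, f x ∂(MeasureTheory.Measure.pi fun _ : E => μ) ≤ C ^ Fintype.card E * f x₀ := by
  intro E X _ _ _ μ _ f hf C hC x₀
  have h := lmarginal_le_pow_card_mul μ hf hC Finset.univ x₀
  rwa [lmarginal_univ, Finset.card_univ] at h

end Summit.QuantumFields.QCD.Cruxes.PhaseQuenchedFlavourDecay.CrossingSplitIntegrability
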